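import Summits.HodgeConjecture.CorCM.Census.OcticCyclicSpecies

/-!
# Octic atlas, type `ℤ/8` — the single atom as a CONIVEAU statement: `HC(F-slice) ⟺ GHC(B₁; H³, coniveau 1) ⟺ GHC(B₀) ∧ GHC(B₁)` (kernel census)

COR-CM (cell `pub-hodgecm2`), count-neutral kernel census by the PORTFOLIO seat lit-andre-3 (gen 9; ask A6-R15 of
`HOME/pub-hodgecm2-lit-andre-3/PORTFOLIO-lit-andre-3-g8.md` §6).  Sequel of `Census/OcticCyclicSpecies.lean` (gen 8), whose
vocabulary is reused BY NAME (`Pt`, `q`, `act`, `phi`, `hodgeForm`, `wt`, `pairOf`, `orbitRep`, `atom`, `isHodgeVec_iff`).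
Cell note `HOME/pub-hodgecm2-lit-andre-3/PORTFOLIO-lit-andre-3-g9.md`.  No named fact, no geometry, no `sorry`: `decide`,
`simp`, `omega`, `ring` only.

SETTING (as in gen 8).  `F` a cyclic CM field of degree `8`, `G = Gal(F/ℚ) = ℤ/8`, `c = 4`; the simple CM abelian varieties
split by `F` are the two FOURFOLDS `B₀` (type `{0,1,2,3}`), `B₁` (type `{0,1,3,6}`), both with CM by `F` (e.g.
`F = ℚ(ζ₃₂ − ζ₃₂⁻¹)`).  Gen 8 (`isHodgeVec_iff`, `parity_obstruction`): the Hodge ring of every `B₀^a × B₁^b` is generated by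
divisor classes and ONE Galois orbit `W` of codimension-`2` classes on `B₀ × B₁`, `W ⊗ ℚ̄ = ⊕_g ℚ̄ · e_{0,7+g} ⊗ e_{1,{1,2,3}+g}
⊂ H¹(B₀) ⊗ H³(B₁)`, and no smaller datum suffices; so `HC` for the whole `F`-slice `⟺` the classes of `W` are algebraic.

DICTIONARY (cited, not formalised; dictionary (D) of `Census/DihedralFourCoreLattice.lean` for eigenlines / Pohlmann forms).
* Types.  For a set of labels `P` the square-free monomial `e_P` is an eigenline of the Mumford–Tate torus; under the
  `g`-conjugate complex structure it has Hodge type `(p, |P| − p)`, `p = pcount g P` (`= #{x ∈ P : g·x ∈ Φ}`), and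
  Pohlmann's form is `hodgeForm g (wt P) = 2p − |P|` (`hodgeForm_wt`, PROVED) [cite: Pohlmann1968, Thm 1].  The `ℚ`-span
  `N_P` of the Galois orbit of `e_P` is a `ℚ`-sub-Hodge structure; `N_P ≅ N_Q(k)` (Tate twist) iff all forms of `P` and `Q`
  agree (`hodgeForm_wt_eq_iff`) — the graph class `e_P^∨ ⊗ e_Q` is then Hodge [cite: Pohlmann1968, Thm 1].
* GHC.  Grothendieck's amended general Hodge conjecture `GHC(X, i, r)`: the largest `ℚ`-sub-Hodge structure of `Hⁱ(X, ℚ)`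
  inside `Fʳ Hⁱ` lies in `Nʳ Hⁱ(X, ℚ)` = classes supported on subvarieties of codimension `≥ r` = `Σ f_* H^{i−2r}(Y, ℚ)`
  over desingularisations `f : Y → Z ⊂ X`, `codim Z = r` [cite: GrothendieckTopology1969, pp. 300–301]
  [cite: Abdulali1997GeneralHodge, §2 and Prop. 2.1 with proof, pp. 343–344]; tree: `Literature.AlgebraicGeometry.HodgeTheory.
  GeneralHodgePropertyFor` (`GeneralHodgePropertyCMType.lean`, Voisin's form 11.37), `supportedClasses` (`AlgebraicClasses.lean`).
* Domination [cite: Abdulali2016TateTwists, Def. 3.1, Prop. 3.2, Lemma 3.3, pp. 292; Thm. 5.2, p. 293] (= [cite: Abdulali2005CMHodge,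
  §3, Thm 3, Thm 4 (journal p. 159)], principle due to Grothendieck, proof [cite: Abdulali1997GeneralHodge, Prop. 2.1, pp. 343–344]):
  `A` is DOMINATED by a class `𝒳` if every irreducible `ℚ`-Hodge structure `V` in `H^•(A, ℚ)` is isomorphic to a Tate twist of a
  FULLY TWISTED (`V′^{(w,0)} ≠ 0`) Hodge structure `V′` in the cohomology of some `X ∈ 𝒳` (Def. 3.1); for abelian varieties it is
  enough to match irreducible `G(A)_ℂ`-modules, i.e. EIGENLINES, with fully twisted eigenlines isomorphic as `G(A × X)_ℂ`-modules
  (p. 292 and Lemma 3.3: `ℂ`-dominated ⟹ dominated); and: `A` dominated by `𝒳` and the usual Hodge conjecture for `A × X`,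
  `X ∈ 𝒳` ⟹ GHC for `A` (Prop. 3.2).  Abdulali's Thm. 5.2 (= 2005 Thm 4): powers of a simple `A` with CM by `E` are dominated by
  the PRODUCTS OF ABELIAN VARIETIES WITH CM BY `E` — here `B₀^a × B₁^b`; his proof of Prop. 2.1 also gives the converse mechanism
  used below: an ALGEBRAIC cycle `Z` on `Y × X` acts by `φ(α) = p_{2*}(p_1^* α ∪ [Z])`, so its image is supported on `p₂(Z ∩ p₁⁻¹(·))`.
* Known cases.  GHC is known for CM abelian varieties exactly in the list [cite: Abdulali2016TateTwists, Appendix A item 3, pp. 299–300]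
  (fields with `[Ē : F̄] = 2^d`, CM elliptic curves, `≤ 3` CM elliptic curves, powers of CM surfaces — all via "Galois transitive on CM
  types ⟹ one isogeny class ⟹ dominated by own powers ⟹ nondegenerate ⟹ HC for powers" [cite: Abdulali2005CMHodge, §4 Examples 1–4]);
  a cyclic octic `F` has TWO type orbits, so `B₁` is NOT dominated by its own powers (`dominated₁`: the piece `N` needs `B₀`) and
  is not on the list.  HC ⟹ GHC for ALL CM abelian varieties: Hazama 2002 / Abdulali 2005 (tree fact
  `Abdulali2005_generalHodge_cmType_of_hodge_cmType`, hypothesis `HC_CM`).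
* Riemann (tree `DeligneMilne1982_Thm_6_20_full`: `H¹` is fully faithful on abelian varieties up to isogeny, essential image =
  polarisable weight-one structures) with Poincaré reducibility; Albanese functoriality (`H¹(Y) = H¹(Alb Y)`); Lieberman: on an
  abelian variety the inverse `Λ` of the Lefschetz operator is algebraic (tree fact `Lieberman1968_lefschetzInvolution_algebraic_
  abelianVariety`) [cite: Lieberman1968, main theorem]; Künneth components of algebraic classes on abelian varieties are algebraic
  [cite: Kleiman1968AlgebraicCycles, §2 Appendix / Lieberman].

KERNEL (this file).  `hodgeForm_wt`, `hodge_wt_iff`, `hodgeForm_wt_eq_iff` (PROVED identities: types ↔ Pohlmann forms) ·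
`h3_level_census` (the `7 + 7` Galois orbits of `H³(B₁)`, `H³(B₀)`; level `≤ 1` = `3` divisorial orbits + ONE pairless orbit `N`,
resp. `N′`) · `types_N`, `types_pair_triples` · `levelOne_pieces_are_H1` (`N(1) ≅ H¹(B₀)`, `N′(1) ≅ H¹(B₁)`, type by type for all
conjugates) · `pairless_type_determines` (multiplicity one) · `hodge13_iff`, `hodge31_iff` (the Hodge classes of Künneth types
`(1,3)` / `(3,1)` on `B₀ × B₁` are EXACTLY the atom orbit `W ⊂ H¹(B₀) ⊗ N` / its mirror `W′ ⊂ N′ ⊗ H¹(B₁)`) ·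
`atom_and_mirror_hodge`, `mirror_generates` (`ℤ⟨pairs, W′⟩ = ℤ⟨pairs, W⟩ =` the Hodge lattice) · `dominated₁`, `dominated₀`,
`foreign_rows` (Abdulali domination census: `B₁` and `B₀` are `ℂ`-dominated by `{B₀, B₁, B₀ × B₁}`, all pieces SELF-dominated
except `N, M, N∧NS` resp. `N′, M′, N′∧NS`).

THEOREM (informal; complete given the DICTIONARY and gen 8's lattice theorem with (O1)–(O4) of `Census/DihedralFourCoreLattice.lean`).
Let `F` be a cyclic CM field of degree `8` and `B₀`, `B₁` the two simple abelian fourfolds with CM by `F` (up to isogeny).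
The following are equivalent:
 (1) the Hodge conjecture for every `B₀^a × B₁^b` (= for every abelian variety whose simple factors have CM fields inside `F`);
 (2) ONE algebraic cycle of codimension `2` on `B₀ × B₁` whose class has a non-zero coordinate on an eigenline of `W`
     (`e_{0,7} ⊗ e_{1,1} ∧ e_{1,2} ∧ e_{1,3}` or a conjugate);
 (3) Grothendieck's general Hodge conjecture for `B₀` and for `B₁`, in all degrees and coniveaux;
 (4) `GHC(B₁; 3, 1)`, equivalently (`pairless_type_determines`, `h3_level_census`) `N ⊂ N¹H³(B₁, ℚ)`: the rank-`8` level-one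
     piece `N` of `H³(B₁)` is supported on a divisor;   (4′) the same for `N′ ⊂ H³(B₀, ℚ)`;
 (5) there are a smooth projective threefold `T` and morphisms `f : T → B₀`, `j : T → B₁` with `j_* ∘ f^* ≠ 0` on `H¹(B₀, ℚ)`
     (equivalently: `B₀` is an isogeny factor of the Albanese variety of a desingularised divisor of `B₁`, coupled non-trivially
     through the Gysin map).
PROOF.  (1)⟹(3): `dominated₁`/`dominated₀` + Lemma 3.3 + Prop. 3.2 of [Abdulali2016TateTwists] — only `HC(B_i × Y)`,
`Y ∈ {B₀, B₁, B₀ × B₁}`, is used (also: Thm. 5.2 there directly).  (3)⟹(4),(4′): `N ⊂ F¹H³(B₁)` is a `ℚ`-sub-Hodge structure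
(`h3_level_census`, `types_N`).  (4)⟹(5): `N¹H³ = Σ f_* H¹(Y, ℚ)(−1)` over desingularised divisors `f : Y → B₁` (finitely many
suffice; `Y` := their disjoint union, `T := Y`); `H¹(Y) = H¹(Alb Y)` is polarisable, so by semisimplicity a sub-Hodge structure
`Ñ ⊂ H¹(Y)(−1)` maps isomorphically onto `N`; `Ñ(1) ≅ N(1) ≅ H¹(B₀)` (`levelOne_pieces_are_H1` + Riemann), so by Riemann and
Poincaré reducibility `Ñ(1) = φ^* H¹(B₀)` for a surjective homomorphism `φ : Alb Y → B₀`; `f := φ ∘ alb_Y`.  (5)⟹(2): the cycle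
`Γ = (f, j)_* [T] ∈ CH₃(B₀ × B₁)` acts on `H¹(B₀)` by `j_* f^* ≠ 0`; the image is a quotient of the irreducible `H¹(B₀)`, hence
`≅ H¹(B₀)(−1)`, hence (multiplicity one: `hodge13_iff` = `Hom_HS(H¹(B₀)(−1), H³(B₁))` is the `F`-line through `N`) it is `N` and
the Künneth `(7,3)`-component of `[Γ]` is a non-zero class in `H⁷(B₀) ⊗ N`; applying Lieberman's algebraic `Λ³_{B₀} ⊗ id`
(an algebraic correspondence; `L³ : H¹(B₀) ≅ H⁷(B₀)`) gives an ALGEBRAIC non-zero class in `H¹(B₀) ⊗ N`, all of whose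
eigen-coordinates lie on `W`-lines (`hodge13_iff`) and, the class being rational and non-zero, some — hence every conjugate —
coordinate is non-zero.  (2)⟹(1): gen 8 (`isHodgeVec_iff`, `μ = 1`, (O1)–(O4)).  (2)⟹(4) directly: `N` is the image of
`H⁷(B₀) = N³H⁷(B₀)` (hard Lefschetz: `L³ H¹`, supported on a curve) under an algebraic correspondence of codimension `2`,
hence supported in codimension `3 + 2 − 4 = 1` [cite: Abdulali1997GeneralHodge, proof of Prop. 2.1, p. 344].  (4′): by
`mirror_generates` / `hodge31_iff` the whole argument runs with the factors exchanged.  ∎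
COROLLARIES.  (a) For a simple abelian fourfold `B` with CM by a cyclic octic field, GHC holds UNCONDITIONALLY for every
irreducible piece of `H^•(B, ℚ)` except possibly `N ⊂ H³`, `M ⊂ H⁴` (rank `8`, level `2`), `N ∧ NS ⊂ H⁵` (`dominated₁`: all other
rows are self-dominated and `HC(B × B)` holds — the Hodge ring of `B^n` is generated by divisors, gen 8), and for those three it is
equivalent to the single statement (4).  (b) The `ℤ/8` row of the octic atlas is the FIRST cyclic Galois type not covered by
[Abdulali2016TateTwists, App. A (3a)/(3d)] (one type orbit ⟹ GHC known): two type orbits, and GHC(`B₁`) ⟺ HC(`F`-slice) ⟺ `W`.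
(c) None of the other five octic closure types has such a reading: their atoms are K3-type pieces of `H²` (level `2`, gen 8 §0(3)),
on which GHC is empty.

## References
* [Pohlmann1968] H. Pohlmann, Ann. of Math. 88 (1968), Thm 1.  [GrothendieckTopology1969] A. Grothendieck, Topology 8 (1969), pp. 299–301.
* [Abdulali1997GeneralHodge] S. Abdulali, Compositio Math. 109 (1997), §2, Prop. 2.1 (pp. 343–344).
* [Abdulali2005CMHodge] S. Abdulali, J. Ramanujan Math. Soc. 20 (2005), §3 Thm 3, Thm 4 (p. 159), §4 Examples 1–4 (pp. 160–161).
* [Abdulali2016TateTwists] S. Abdulali, in LMS LN 427 (2016), Def. 3.1, Prop. 3.2, Lemma 3.3 (p. 292), Thm. 5.2 (p. 293), App. A (pp. 299–300).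
* [Lieberman1968] D. Lieberman, Amer. J. Math. 90 (1968), main theorem.  [Kleiman1968AlgebraicCycles] S. Kleiman, Dix exposés (1968), §2.

## Provenance
Exact oracles (seat folder `run/sessions/literature-prover-pub-hodgecm2-lit-andre-3-g9-0/folder/scratch/`, copies in
`HOME/pub-hodgecm2-lit-andre-3/g9/`): `coniveau8.py` (orbits, levels, Hodge `(1,3)/(3,1)` monomials, mirror generation,
multiplicity one, domination search over all `ℕ^16` exponent vectors of the right weight), `gen_coniveau.py` / `make_lean.py`
(the tables of this file, with the row checks re-asserted in Python before emission).
-/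

namespace Summit.HodgeConjecture.CorCM.Census.OcticCyclicConiveau

open Finset
open Summit.HodgeConjecture.CorCM.Census.OcticCyclicSpecies

/-! ## Hodge types of square-free monomials -/

/-- The `p` of the Hodge type `(p, |P| - p)` of the square-free class monomial `e_P = ⊗_{x ∈ P} e_x` for the
`g`-conjugate complex structure (equivalently: of the Galois-conjugate eigenline `e_{g·P}`): the number of labels
of `P` that `g` moves into the total CM type `Φ`. [cite: Pohlmann1968, Thm 1] -/
def pcount (g : ZMod 8) (P : Finset Pt) : ℕ := (P.filter fun x => act g x ∈ phi).card

/-- The labels of block `i` (`B₀`: `i = 0`, `B₁`: `i = 1`) indexed by a set of exponents `S ⊆ ℤ/8`: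
the wedge monomial `e_{i,S} ∈ H^{|S|}(B_i)`. [folklore] -/
def lab (i : Fin 2) (S : Finset (ZMod 8)) : Finset Pt := S.image (q i)

/-- Pohlmann's Hodge form of a square-free monomial is `p - q = 2p - |P|`. [cite: Pohlmann1968, Thm 1] -/
theorem hodgeForm_wt (g : ZMod 8) (P : Finset Pt) :
    hodgeForm g (wt P) = 2 * (pcount g P : ℤ) - (P.card : ℤ) := by
  have h1 : ∀ x : Pt, (if act g x ∈ phi then wt P x else -wt P x)
      = if x ∈ P then (if act g x ∈ phi then (1 : ℤ) else -1) else 0 := by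
    intro x; unfold wt; split_ifs <;> simp
  unfold hodgeForm pcount
  simp_rw [h1]
  rw [Finset.sum_ite_mem, Finset.univ_inter, Finset.sum_ite, Finset.sum_const, Finset.sum_const,
    ← Finset.card_filter_add_card_filter_not (s := P) (fun x => act g x ∈ phi)]
  simp only [nsmul_eq_mul, Nat.cast_add, mul_one, mul_neg]
  ring

/-- A square-free monomial is a Hodge class (all eight Pohlmann forms vanish) iff every Galois conjugate has
type `(p, p)`, `2p = |P|`. [cite: Pohlmann1968, Thm 1] -/
theorem hodge_wt_iff (P : Finset Pt) : (∀ g, hodgeForm g (wt P) = 0) ↔ ∀ g, 2 * pcount g P = P.card := by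
  refine forall_congr' fun g => ?_
  rw [hodgeForm_wt]
  omega

/-- Two square-free monomials `e_P` (on one member of the slice) and `e_Q` (on another) span, with their Galois
conjugates, `ℚ`-Hodge structures that are ISOMORPHIC UP TO A TATE TWIST iff all Pohlmann forms agree
(`hodgeForm g (wt P) = hodgeForm g (wt Q)`, i.e. `e_P^∨ ⊗ e_Q` twisted is a Hodge class; dictionary (D) of
`Census/DihedralFourCoreLattice.lean`); in type language: `2·pcount g P - |P| = 2·pcount g Q - |Q|` for all `g`. [cite: Pohlmann1968, Thm 1] -/
theorem hodgeForm_wt_eq_iff (P Q : Finset Pt) :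
    (∀ g, hodgeForm g (wt P) = hodgeForm g (wt Q)) ↔ ∀ g, 2 * pcount g P + Q.card = 2 * pcount g Q + P.card := by
  refine forall_congr' fun g => ?_
  rw [hodgeForm_wt, hodgeForm_wt]
  omega

/-! ## `H³` of the two simple fourfolds: orbits, levels, the two level-one pieces `N ⊂ H³(B₁)`, `N′ ⊂ H³(B₀)` -/

/-- The `56` three-element exponent sets: the eigenlines `e_{i,S}` of `H³(B_i, ℚ̄) = Λ³ H¹`. [folklore] -/
def triples : Finset (Finset (ZMod 8)) := univ.powersetCard 3

/-- `S` contains a conjugate pair `{t, t+4}` (the monomial is a divisor class times `H¹`: `e_t ∧ e_{t+4} ∧ e_y`). [folklore] -/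
def hasPair (S : Finset (ZMod 8)) : Bool := decide (∃ t ∈ S, t + 4 ∈ S)

/-- The translation (= Galois) orbit of an exponent set: the eigenlines spanning ONE `ℚ`-sub-Hodge structure
`N_S ⊂ H^{|S|}(B_i, ℚ)` (an isotypic piece for the Mumford–Tate torus). [folklore] -/
def torb (S : Finset (ZMod 8)) : Finset (Finset (ZMod 8)) := univ.image fun g : ZMod 8 => S.image (g + ·)

/-- LEVEL `≤ 1` for a weight-3 piece: no Galois conjugate of `e_{i,S}` has type `(3,0)` or `(0,3)`, i.e. the
`ℚ`-Hodge structure `N_S` lies in `F¹H³` (Grothendieck's amended GHC then asks `N_S ⊂ N¹H³`). [cite: GrothendieckTopology1969, pp. 300–301] -/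
def levelLEOne (i : Fin 2) (S : Finset (ZMod 8)) : Bool :=
  decide (∀ g : ZMod 8, 1 ≤ pcount g (lab i S) ∧ pcount g (lab i S) ≤ 2)

/-- The exponent set of the level-one PAIRLESS piece `N ⊂ H³(B₁, ℚ)` (orbit representative). [folklore] -/
def repN : Finset (ZMod 8) := {0, 1, 2}

/-- The exponent set of the level-one PAIRLESS piece `N′ ⊂ H³(B₀, ℚ)` (orbit representative). [folklore] -/
def repN' : Finset (ZMod 8) := {0, 2, 5}

set_option maxRecDepth 8000 in
/-- **`H³` census.**  For each simple factor `B_i`: `H³(B_i, ℚ̄)` has `56` eigenlines in `7` Galois orbits of `8`;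
the orbits of level `≤ 1` (inside `F¹H³`) are EXACTLY the `3` orbits through a conjugate pair (`24` lines:
`NS(B_i) ∧ H¹(B_i)`, divisorial, coniveau `1` by Lefschetz `(1,1)`) and ONE pairless orbit — `N = N_{{0,1,2}} ⊂ H³(B₁)`,
resp. `N′ = N_{{0,2,5}} ⊂ H³(B₀)` — of rank `8`; the other three pairless orbits contain a `(3,0)`-line (level `3`,
no coniveau condition). [folklore] -/
theorem h3_level_census :
    triples.card = 56 ∧ (triples.filter fun S => hasPair S).card = 24 ∧
    ((triples.filter fun S => levelLEOne 1 S) = (triples.filter fun S => hasPair S) ∪ torb repN) ∧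
    ((triples.filter fun S => levelLEOne 0 S) = (triples.filter fun S => hasPair S) ∪ torb repN') ∧
    (torb repN).card = 8 ∧ (torb repN').card = 8 ∧
    (∀ S ∈ torb repN, hasPair S = false) ∧ (∀ S ∈ torb repN', hasPair S = false) := by
  refine ⟨by decide, by decide, by decide, by decide, by decide, by decide, by decide, by decide⟩

/-- The Hodge types of `N` and `N′`, conjugate by conjugate: `(2,1)` at `g ∈ {0,1,6,7}` resp. `{0,1,3,6}`, else `(1,2)`
(Hodge numbers `(2,1)⁴(1,2)⁴`). [folklore] -/
theorem types_N :
    (∀ g : ZMod 8, pcount g (lab 1 repN) = if g ∈ ({0, 1, 6, 7} : Finset (ZMod 8)) then 2 else 1) ∧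
    (∀ g : ZMod 8, pcount g (lab 0 repN') = if g ∈ ({0, 1, 3, 6} : Finset (ZMod 8)) then 2 else 1) := by
  refine ⟨by decide, by decide⟩

/-- The pair orbits are `H¹` up to the twist by a divisor class: conjugate by conjugate, the type of
`e_t ∧ e_{t+4} ∧ e_y` is the type of `e_y` plus `(1,1)` (both blocks). [folklore] -/
theorem types_pair_triples :
    ∀ i : Fin 2, ∀ t y : ZMod 8, y ≠ t → y ≠ t + 4 → ∀ g : ZMod 8,
      pcount g (lab i {t, t + 4, y}) = pcount g (lab i {y}) + 1 := by
  decide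

/-- **`N(1) ≅ H¹(B₀, ℚ)` and `N′(1) ≅ H¹(B₁, ℚ)` as `ℚ`-Hodge structures with their `F`-actions** (type level, for
EVERY conjugate complex structure `g`): `e_{0,t}` has type `(1,0)` iff the `N`-line `e_{1,{t-2,t-1,t}}` has type `(2,1)`,
and `e_{1,t}` has type `(1,0)` iff the `N′`-line `e_{0,{t,t+2,t+5}}` has type `(2,1)`; the matchings `t ↦ {t-2,t-1,t}`,
`t ↦ {t,t+2,t+5}` are `G`-equivariant by construction, so (Riemann) `N`, `N′` are the `H¹` of abelian fourfolds
isogenous to `B₀`, `B₁` respectively, Tate-twisted once. [folklore] -/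
theorem levelOne_pieces_are_H1 :
    (∀ g t : ZMod 8, act g (q 0 t) ∈ phi ↔ pcount g (lab 1 {t + 6, t + 7, t}) = 2) ∧
    (∀ g t : ZMod 8, act g (q 1 t) ∈ phi ↔ pcount g (lab 0 {t, t + 2, t + 5}) = 2) := by
  refine ⟨by decide, by decide⟩

/-- **Multiplicity one.**  A PAIRLESS weight-3 eigenline is determined by its type vector `g ↦ p_g` among ALL `56`
(both blocks): its Mumford–Tate character occurs once in `H³(B_i)`, so `N_S` is an irreducible `ℚ`-Hodge structure
met by no other isotypic piece, and every `ℚ`-sub-Hodge structure of `H³(B_i)` is `(sub of the divisorial part) ⊕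
(some of the four pairless N_S)`.  Consequently the largest `ℚ`-sub-Hodge structure of `H³(B₁)` inside `F¹H³` is
`NS ∧ H¹ ⊕ N` (resp. `NS ∧ H¹ ⊕ N′` for `B₀`), and `GHC(B₁, 3, 1) ⟺ N ⊂ N¹H³(B₁, ℚ)`. [folklore] -/
theorem pairless_type_determines :
    ∀ i : Fin 2, ∀ S ∈ triples, ∀ T ∈ triples, hasPair S = false →
      (∀ g : ZMod 8, pcount g (lab i S) = pcount g (lab i T)) → S = T := by
  decide +kernel

/-! ## The atom `W` and its mirror `W′`: the only Hodge classes of Künneth types `(1,3)` and `(3,1)` on `B₀ × B₁` -/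

set_option maxRecDepth 8000 in
/-- **The `(1,3)` Hodge monomials are exactly the atom orbit.**  `e_{0,s} ⊗ e_{1,S}` (`|S| = 3`) is a Hodge class on
`B₀ × B₁` iff `S = {s+2, s+3, s+4}`; these eight monomials are the `G`-translates of gen 8's `orbitRep 0`
(`= {q 0 7, q 1 1, q 1 2, q 1 3}`), i.e. they span `W ⊂ H¹(B₀) ⊗ N ⊂ H⁴(B₀ × B₁, ℚ)`: `Hom_HS(H¹(B₀)(-1)^∨-twist, H³(B₁))`
lands in `N` and is one `F`-line.  Type form (`hodge_wt_iff` converts to Pohlmann forms). [cite: Pohlmann1968, Thm 1] -/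
theorem hodge13_iff :
    (∀ s : ZMod 8, ∀ S ∈ triples, (∀ g : ZMod 8, 2 * pcount g ({q 0 s} ∪ lab 1 S) = 4) ↔ S = {s + 2, s + 3, s + 4}) ∧
    (∀ s : ZMod 8, {q 0 s} ∪ lab 1 {s + 2, s + 3, s + 4} = (orbitRep 0).image (act (s + 1))) := by
  refine ⟨by decide, by decide⟩

/-- The MIRROR atom `W′`: representative `R′ = e_{0,0} ∧ e_{0,2} ∧ e_{0,5} ⊗ e_{1,4} ∈ H³(B₀) ⊗ H¹(B₁)` (Künneth type `(3,1)`). [folklore] -/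
def mirrorRep : Finset Pt := {q 0 0, q 0 2, q 0 5, q 1 4}

set_option maxRecDepth 8000 in
/-- **The `(3,1)` Hodge monomials are exactly the mirror orbit**: `e_{0,S} ⊗ e_{1,t}` is a Hodge class iff
`S = {t+1, t+4, t+6}`, the `G`-translates of `mirrorRep`; they span `W′ ⊂ N′ ⊗ H¹(B₁) ⊂ H⁴(B₀ × B₁, ℚ)`. [cite: Pohlmann1968, Thm 1] -/
theorem hodge31_iff :
    (∀ t : ZMod 8, ∀ S ∈ triples, (∀ g : ZMod 8, 2 * pcount g (lab 0 S ∪ {q 1 t}) = 4) ↔ S = {t + 1, t + 4, t + 6}) ∧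
    (∀ t : ZMod 8, lab 0 {t + 1, t + 4, t + 6} ∪ {q 1 t} = mirrorRep.image (act (t + 4))) := by
  refine ⟨by decide, by decide⟩

/-- All eight translates of the atom and of the mirror atom are Hodge classes (all Pohlmann forms vanish). [cite: Pohlmann1968, Thm 1] -/
theorem atom_and_mirror_hodge :
    (∀ s g : ZMod 8, hodgeForm g (wt ((orbitRep 0).image (act s))) = 0) ∧
    (∀ s g : ZMod 8, hodgeForm g (wt (mirrorRep.image (act s))) = 0) := by
  constructor
  · intro s; rw [hodge_wt_iff]; revert s; decide
  · intro s; rw [hodge_wt_iff]; revert s; decide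

/-- **The mirror orbit generates too.**  Each of gen 8's four basis atoms (`atom k`, with the eight pairs a `ℤ`-basis
of the Hodge lattice `H` by `isHodgeVec_iff`) is an INTEGRAL combination of conjugate pairs and translates of
`mirrorRep`; with `atom_and_mirror_hodge`, `ℤ⟨pairs, W′-orbit⟩ = H = ℤ⟨pairs, W-orbit⟩`: the single obstruction of
the `ℤ/8` slice may be read on EITHER factor (`N ⊂ H³(B₁)` or `N′ ⊂ H³(B₀)`).  Exact oracle `scratch/coniveau8.py`. [folklore] -/
theorem mirror_generates :
    (∀ x, wt (atom 0) x = wt (pairOf (q 0 0)) x + wt (pairOf (q 0 1)) x + wt (pairOf (q 0 2)) x + 2 * wt (pairOf (q 0 3)) x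
        + wt (pairOf (q 1 1)) x + wt (pairOf (q 1 2)) x + wt (pairOf (q 1 3)) x
        - wt (mirrorRep.image (act 1)) x - wt (mirrorRep.image (act 2)) x - wt (mirrorRep.image (act 3)) x) ∧
    (∀ x, wt (atom 1) x = wt (pairOf (q 0 0)) x + wt (pairOf (q 0 1)) x + 2 * wt (pairOf (q 0 2)) x + wt (pairOf (q 0 3)) x
        + wt (pairOf (q 1 0)) x + wt (pairOf (q 1 1)) x + wt (pairOf (q 1 2)) x
        - wt (mirrorRep.image (act 0)) x - wt (mirrorRep.image (act 1)) x - wt (mirrorRep.image (act 2)) x) ∧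
    (∀ x, wt (atom 2) x = wt (pairOf (q 0 0)) x + 2 * wt (pairOf (q 0 1)) x + wt (pairOf (q 0 2)) x + wt (pairOf (q 0 3)) x
        + wt (pairOf (q 1 0)) x + wt (pairOf (q 1 1)) x + wt (pairOf (q 1 3)) x
        - wt (mirrorRep.image (act 0)) x - wt (mirrorRep.image (act 1)) x - wt (mirrorRep.image (act 7)) x) ∧
    (∀ x, wt (atom 3) x = 2 * wt (pairOf (q 0 0)) x + wt (pairOf (q 0 1)) x + wt (pairOf (q 0 2)) x + wt (pairOf (q 0 3)) x
        + wt (pairOf (q 1 0)) x + wt (pairOf (q 1 2)) x + wt (pairOf (q 1 3)) x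
        - wt (mirrorRep.image (act 0)) x - wt (mirrorRep.image (act 6)) x - wt (mirrorRep.image (act 7)) x) := by
  refine ⟨?_, ?_, ?_, ?_⟩ <;> decide +kernel

/-! ## Domination census (Abdulali): `B₀` and `B₁` are `ℂ`-dominated by `{B₀, B₁, B₀ × B₁}` -/

/-- Domination table for `B₁`: one row `(S, W)` per Galois orbit of exponent sets `S ⊆ ℤ/8` (the irreducible
`ℚ`-Hodge structures `N_S ⊂ H^{|S|}(B₁, ℚ)`, `36` orbits), with a FULLY TWISTED witness monomial `e_W`
(`W ⊆` labels of `B₀ ⊔ B₁`, square-free, so its carrier is `B₀`, `B₁` or `B₀ × B₁`) spanning with its conjugates a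
`ℚ`-Hodge structure isomorphic to a Tate twist of `N_S` and containing a `(|W|, 0)`-line (`dominated₁`).  All rows
are self-dominated (`W = e_{1,S}` or a sub-monomial on `B₁`) EXCEPT three: `N = N_{{0,1,2}} ⊂ H³` (`W = e_{0,2}`, on `B₀`),
`M = N_{{0,1,2,3}} ⊂ H⁴` (level `2`; `W = e_{0,2} ⊗ e_{1,3}`, on `B₀ × B₁`), `N_{{0,1,2,3,4}} = N ∧ NS ⊂ H⁵` (`W = e_{0,3}`, on `B₀`).
Exact oracle `scratch/coniveau8.py` / `scratch/gen_coniveau.py`. [cite: Abdulali2016TateTwists, Def. 3.1 and p. 292] -/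
def domTable₁ : List (Finset (ZMod 8) × Finset Pt) := [
  ((∅ : Finset (ZMod 8)), (∅ : Finset Pt)), (({0} : Finset (ZMod 8)), ({q 1 0} : Finset Pt)),
  (({0, 1} : Finset (ZMod 8)), ({q 1 0, q 1 1} : Finset Pt)), (({0, 2} : Finset (ZMod 8)), ({q 1 0, q 1 2} : Finset Pt)),
  (({0, 3} : Finset (ZMod 8)), ({q 1 0, q 1 3} : Finset Pt)), (({0, 4} : Finset (ZMod 8)), (∅ : Finset Pt)),
  (({0, 1, 2} : Finset (ZMod 8)), ({q 0 2} : Finset Pt)), (({0, 1, 3} : Finset (ZMod 8)), ({q 1 0, q 1 1, q 1 3} : Finset Pt)),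
  (({0, 1, 4} : Finset (ZMod 8)), ({q 1 1} : Finset Pt)), (({0, 1, 5} : Finset (ZMod 8)), ({q 1 0} : Finset Pt)),
  (({0, 1, 6} : Finset (ZMod 8)), ({q 1 0, q 1 1, q 1 6} : Finset Pt)), (({0, 2, 4} : Finset (ZMod 8)), ({q 1 2} : Finset Pt)),
  (({0, 2, 5} : Finset (ZMod 8)), ({q 1 0, q 1 2, q 1 5} : Finset Pt)), (({0, 1, 2, 3} : Finset (ZMod 8)), ({q 0 2, q 1 3} : Finset Pt)),
  (({0, 1, 2, 4} : Finset (ZMod 8)), ({q 1 1, q 1 2} : Finset Pt)), (({0, 1, 2, 5} : Finset (ZMod 8)), ({q 1 0, q 1 2} : Finset Pt)),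
  (({0, 1, 2, 6} : Finset (ZMod 8)), ({q 1 0, q 1 1} : Finset Pt)), (({0, 1, 3, 4} : Finset (ZMod 8)), ({q 1 1, q 1 3} : Finset Pt)),
  (({0, 1, 3, 5} : Finset (ZMod 8)), ({q 1 0, q 1 3} : Finset Pt)), (({0, 1, 3, 6} : Finset (ZMod 8)), ({q 1 0, q 1 1, q 1 3, q 1 6} : Finset Pt)),
  (({0, 1, 4, 5} : Finset (ZMod 8)), (∅ : Finset Pt)), (({0, 1, 4, 6} : Finset (ZMod 8)), ({q 1 1, q 1 6} : Finset Pt)),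
  (({0, 2, 4, 6} : Finset (ZMod 8)), (∅ : Finset Pt)), (({0, 1, 2, 3, 4} : Finset (ZMod 8)), ({q 0 3} : Finset Pt)),
  (({0, 1, 2, 3, 5} : Finset (ZMod 8)), ({q 1 0, q 1 2, q 1 3} : Finset Pt)), (({0, 1, 2, 3, 6} : Finset (ZMod 8)), ({q 1 0, q 1 1, q 1 3} : Finset Pt)),
  (({0, 1, 2, 4, 5} : Finset (ZMod 8)), ({q 1 2} : Finset Pt)), (({0, 1, 2, 4, 6} : Finset (ZMod 8)), ({q 1 1} : Finset Pt)),
  (({0, 1, 2, 5, 6} : Finset (ZMod 8)), ({q 1 0} : Finset Pt)), (({0, 1, 3, 4, 6} : Finset (ZMod 8)), ({q 1 1, q 1 3, q 1 6} : Finset Pt)),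
  (({0, 1, 2, 3, 4, 5} : Finset (ZMod 8)), ({q 1 2, q 1 3} : Finset Pt)), (({0, 1, 2, 3, 4, 6} : Finset (ZMod 8)), ({q 1 1, q 1 3} : Finset Pt)),
  (({0, 1, 2, 3, 5, 6} : Finset (ZMod 8)), ({q 1 0, q 1 3} : Finset Pt)), (({0, 1, 2, 4, 5, 6} : Finset (ZMod 8)), (∅ : Finset Pt)),
  (({0, 1, 2, 3, 4, 5, 6} : Finset (ZMod 8)), ({q 1 3} : Finset Pt)), (({0, 1, 2, 3, 4, 5, 6, 7} : Finset (ZMod 8)), (∅ : Finset Pt))]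

/-- Domination table for `B₀` (same format): all rows self-dominated EXCEPT `N′ = N_{{0,2,5}} ⊂ H³` (`W = e_{1,0}`, on `B₁`),
`M′ = N_{{0,1,3,6}} ⊂ H⁴` (`W = e_{0,0} ⊗ e_{1,1}`, on `B₀ × B₁`), `N_{{0,1,3,4,6}} = N′ ∧ NS ⊂ H⁵` (`W = e_{1,1}`, on `B₁`). [cite: Abdulali2016TateTwists, Def. 3.1 and p. 292] -/
def domTable₀ : List (Finset (ZMod 8) × Finset Pt) := [
  ((∅ : Finset (ZMod 8)), (∅ : Finset Pt)), (({0} : Finset (ZMod 8)), ({q 0 0} : Finset Pt)),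
  (({0, 1} : Finset (ZMod 8)), ({q 0 0, q 0 1} : Finset Pt)), (({0, 2} : Finset (ZMod 8)), ({q 0 0, q 0 2} : Finset Pt)),
  (({0, 3} : Finset (ZMod 8)), ({q 0 0, q 0 3} : Finset Pt)), (({0, 4} : Finset (ZMod 8)), (∅ : Finset Pt)),
  (({0, 1, 2} : Finset (ZMod 8)), ({q 0 0, q 0 1, q 0 2} : Finset Pt)), (({0, 1, 3} : Finset (ZMod 8)), ({q 0 0, q 0 1, q 0 3} : Finset Pt)),
  (({0, 1, 4} : Finset (ZMod 8)), ({q 0 1} : Finset Pt)), (({0, 1, 5} : Finset (ZMod 8)), ({q 0 0} : Finset Pt)),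
  (({0, 1, 6} : Finset (ZMod 8)), ({q 0 0, q 0 1, q 0 6} : Finset Pt)), (({0, 2, 4} : Finset (ZMod 8)), ({q 0 2} : Finset Pt)),
  (({0, 2, 5} : Finset (ZMod 8)), ({q 1 0} : Finset Pt)), (({0, 1, 2, 3} : Finset (ZMod 8)), ({q 0 0, q 0 1, q 0 2, q 0 3} : Finset Pt)),
  (({0, 1, 2, 4} : Finset (ZMod 8)), ({q 0 1, q 0 2} : Finset Pt)), (({0, 1, 2, 5} : Finset (ZMod 8)), ({q 0 0, q 0 2} : Finset Pt)),
  (({0, 1, 2, 6} : Finset (ZMod 8)), ({q 0 0, q 0 1} : Finset Pt)), (({0, 1, 3, 4} : Finset (ZMod 8)), ({q 0 1, q 0 3} : Finset Pt)),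
  (({0, 1, 3, 5} : Finset (ZMod 8)), ({q 0 0, q 0 3} : Finset Pt)), (({0, 1, 3, 6} : Finset (ZMod 8)), ({q 0 0, q 1 1} : Finset Pt)),
  (({0, 1, 4, 5} : Finset (ZMod 8)), (∅ : Finset Pt)), (({0, 1, 4, 6} : Finset (ZMod 8)), ({q 0 1, q 0 6} : Finset Pt)),
  (({0, 2, 4, 6} : Finset (ZMod 8)), (∅ : Finset Pt)), (({0, 1, 2, 3, 4} : Finset (ZMod 8)), ({q 0 1, q 0 2, q 0 3} : Finset Pt)),
  (({0, 1, 2, 3, 5} : Finset (ZMod 8)), ({q 0 0, q 0 2, q 0 3} : Finset Pt)), (({0, 1, 2, 3, 6} : Finset (ZMod 8)), ({q 0 0, q 0 1, q 0 3} : Finset Pt)),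
  (({0, 1, 2, 4, 5} : Finset (ZMod 8)), ({q 0 2} : Finset Pt)), (({0, 1, 2, 4, 6} : Finset (ZMod 8)), ({q 0 1} : Finset Pt)),
  (({0, 1, 2, 5, 6} : Finset (ZMod 8)), ({q 0 0} : Finset Pt)), (({0, 1, 3, 4, 6} : Finset (ZMod 8)), ({q 1 1} : Finset Pt)),
  (({0, 1, 2, 3, 4, 5} : Finset (ZMod 8)), ({q 0 2, q 0 3} : Finset Pt)), (({0, 1, 2, 3, 4, 6} : Finset (ZMod 8)), ({q 0 1, q 0 3} : Finset Pt)),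
  (({0, 1, 2, 3, 5, 6} : Finset (ZMod 8)), ({q 0 0, q 0 3} : Finset Pt)), (({0, 1, 2, 4, 5, 6} : Finset (ZMod 8)), (∅ : Finset Pt)),
  (({0, 1, 2, 3, 4, 5, 6} : Finset (ZMod 8)), ({q 0 3} : Finset Pt)), (({0, 1, 2, 3, 4, 5, 6, 7} : Finset (ZMod 8)), (∅ : Finset Pt))]

set_option maxRecDepth 8000 in
/-- **Domination census for `B₁`.**  (i) the `36` orbit representatives cover all `256` exponent sets (every
irreducible `ℚ`-sub-Hodge structure of `H^•(B₁, ℚ)` is an `N_S`, up to isomorphism); (ii) for every row `(S, W)`: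
all eight Pohlmann forms of `e_{1,S}` and `e_W` agree (`hodgeForm_wt_eq_iff`: `N_W ≅ N_S(k)`, `2k = |S| - |W|`) and some
conjugate of `e_W` has type `(|W|, 0)` (fully twisted).  With Pohlmann's dictionary this is Abdulali's
`ℂ`-domination of `B₁` by `{B₀, B₁, B₀ × B₁}` (eigenlines = irreducible `G(B₁)_ℂ`-modules; equal forms = isomorphic
`G(B₁ × Y)_ℂ`-modules), hence domination [cite: Abdulali2016TateTwists, Lemma 3.3]. [cite: Abdulali2016TateTwists, Def. 3.1] -/
theorem dominated₁ :
    ((domTable₁.map Prod.fst).toFinset.biUnion torb = (univ : Finset (ZMod 8)).powerset) ∧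
    (∀ p ∈ domTable₁, (∀ g : ZMod 8, 2 * pcount g (lab 1 p.1) + p.2.card = 2 * pcount g p.2 + p.1.card) ∧
      (∃ g : ZMod 8, pcount g p.2 = p.2.card)) := by
  refine ⟨by decide +kernel, ?_⟩
  have h : domTable₁.all (fun p => decide ((∀ g : ZMod 8, 2 * pcount g (lab 1 p.1) + p.2.card = 2 * pcount g p.2 + p.1.card) ∧
      (∃ g : ZMod 8, pcount g p.2 = p.2.card))) = true := by decide +kernel
  intro p hp
  exact of_decide_eq_true (List.all_eq_true.1 h p hp)

set_option maxRecDepth 8000 in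
/-- **Domination census for `B₀`** (same statement for `domTable₀`). [cite: Abdulali2016TateTwists, Def. 3.1] -/
theorem dominated₀ :
    ((domTable₀.map Prod.fst).toFinset.biUnion torb = (univ : Finset (ZMod 8)).powerset) ∧
    (∀ p ∈ domTable₀, (∀ g : ZMod 8, 2 * pcount g (lab 0 p.1) + p.2.card = 2 * pcount g p.2 + p.1.card) ∧
      (∃ g : ZMod 8, pcount g p.2 = p.2.card)) := by
  refine ⟨by decide +kernel, ?_⟩
  have h : domTable₀.all (fun p => decide ((∀ g : ZMod 8, 2 * pcount g (lab 0 p.1) + p.2.card = 2 * pcount g p.2 + p.1.card) ∧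
      (∃ g : ZMod 8, pcount g p.2 = p.2.card))) = true := by decide +kernel
  intro p hp
  exact of_decide_eq_true (List.all_eq_true.1 h p hp)

/-- The three NON-self-dominated pieces of each factor, explicitly (rows of the tables): their witnesses live on the
OTHER factor or on `B₀ × B₁` — so Grothendieck–Abdulali's principle needs the usual Hodge conjecture exactly on
`B₀ × B₁` and `B₀ × B₁ × B_i`, i.e. (atlas, `μ = 1`) exactly the atom `W`. [folklore] -/
theorem foreign_rows :
    (domTable₁.filter fun p => decide (∃ x ∈ p.2, x.1 = 0)) =
      [(({0, 1, 2} : Finset (ZMod 8)), ({q 0 2} : Finset Pt)), (({0, 1, 2, 3} : Finset (ZMod 8)), ({q 0 2, q 1 3} : Finset Pt)),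
       (({0, 1, 2, 3, 4} : Finset (ZMod 8)), ({q 0 3} : Finset Pt))] ∧
    (domTable₀.filter fun p => decide (∃ x ∈ p.2, x.1 = 1)) =
      [(({0, 2, 5} : Finset (ZMod 8)), ({q 1 0} : Finset Pt)), (({0, 1, 3, 6} : Finset (ZMod 8)), ({q 0 0, q 1 1} : Finset Pt)),
       (({0, 1, 3, 4, 6} : Finset (ZMod 8)), ({q 1 1} : Finset Pt))] := by
  refine ⟨by decide +kernel, by decide +kernel⟩

end Summit.HodgeConjecture.CorCM.Census.OcticCyclicConiveau
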